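import Mathlib
import HarnessLib
import HarnessLib.Audit
import Summits.ABC.Statement
import Literature.Barriers.ABC.BakerMethodBoundsStewartTijdemanGenericProofs
import Literature.Barriers.ABC.BakerMethodBoundsEpsShape
import HarnessLib.Audit.Status.Attr

/-!
Route: PadicPrincipalCoreRadFiveHalves

CLOSED (proved) 2026-08-26T13:02:45Z by planner-abc-stewartyu-plan-g6-0 — reason: proved:Summit.ABC.StewartYu.epsShapeBoundFiveHalves_holds — note: rung F-A1.M1⁺(5/2) EpsShapeBoundFiveHalves proved in tree by name (Summits/ABC/StewartYu/PadicCW77EpsShapeFiveHalves.lean:97, epsShapeBoundFiveHalves_holds); all 5 items closed·proved (19413–19417); dry-run WOULD PASS 12:21Z. The file is kept as the record of this route; refuted decls are indexed as negative knowledge (`ledger negatives`).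

# Route PadicPrincipalCoreRadFiveHalves — log c ≪_ε rad^(5/2+ε) from Theorem A (c₂ ≤ 1) and the
Euclidean Minkowski–Mahler principal basis (loss m^m·√(m!))

RUNG ROUTE A1.M1⁺(5/2) (D-0059/D-0061, class rung, never summit credit): it suffices to show THEOREM
A WITH c₂ ≤ 1 (item
TheoremAOne, shared with route PadicPrincipalCoreRadThree, CLOSED by
`padicPrincipalCoreRadThree_theoremAOne_proof`) together
with WP-M♭ (item WPMFlat): principal generators α_j ≡ 1 (mod p) for the lattice of exponent vectors
z with ∏ q_i^(z_i) ≡ ±1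
(mod p) with ∏ h(α_j) ≤ m^m·√(m!)·p·∏ log q_i instead of WP-M's m^(2m) — Minkowski's second theorem
in the weighted EUCLIDEAN
norm plus Mahler's basis reduction done with nearest planes (Pythagoras: √(m!) instead of m!). The
glue then gives the
one-prime bound at every odd prime with κ ≤ c₂ + 3/2 ≤ 5/2 and the odd κ-door (item
OddKappaDoorSpec, shared, CLOSED) gives
log c ≪_ε rad^(5/2+ε), i.e. the rung leaf `EpsShapeBoundFiveHalves` (between route
PadicPrincipalCoreRadThree's 3 + ε and
the open 2 + ε of the staged WPMSharp line). Every item of this route is PROVED IN THE TREE at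
filing
(`Summit.ABC.StewartYu.epsShapeBound_five_halves`, p418490, p1-g3); the route is the ledger record
of the rung.
Lean: `∀ (p : ℕ), p.Prime → p ≠ 2 → ∀ (m : ℕ) (q : Fin m → ℕ), (∀ i, (q i).Prime) →
Function.Injective q → (∀ i, q i ≠ p) → ∀ (e : Fin m → ℤ), e ≠ 0 → 1 ≤ padicValRat p (∏ i, (q i : ℚ)
^ e i - 1) → ∃ (α : Fin m → ℚ) (e' : Fin m → ℤ), (∀ j, α j ≠ 0 ∧ 1 ≤ padicValRat p (α j - 1)) ∧ (∀ μ
: Fin m → ℤ, ∏ j, α j ^ μ j = 1 → μ = 0) ∧ (∀ T : Finset (Fin m), T.Nonempty → ¬ IsSquare (∏ j ∈ T,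
α j)) ∧ e' ≠ 0 ∧ ∏ i, (q i : ℚ) ^ e i = ∏ j, α j ^ e' j ∧ (∏ j, Height.logHeight₁ (α j)) ≤ (m : ℝ) ^
m * Real.sqrt (m.factorial) * p * ∏ i, Real.log (q i) ∧ (∀ j, (|e' j| : ℝ) ≤ (m : ℝ) ^ (2 * m) * p *
(∏ i, Real.log (q i)) * (Finset.univ.sup fun i => (e i).natAbs)) ∧ (∀ j, Real.log p ≤ 2 *
Height.logHeight₁ (α j))`

## Assembly
Pure logic (`glueB52.lean`, farm rc 0 against `EpsShapeBound (5/2)`): unpack TheoremAOne's witnesses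
(c₂ ≤ 1), feed them
with WP-M♭ to GlueSpecFlat (κ ≤ c₂ + 3/2 ≤ 5/2 at every odd prime, σ = τ = τ₁ = 2), apply the odd
κ-door (exponent
max(1, κ) ≤ 5/2) and `epsShapeBound_mono`.

CLOSES_TARGET: closes rung F-A1.M1⁺(5/2) of ABC: Literature.Barriers.ABC.EpsShapeBoundFiveHalves (D-0061; not the summit Statement) — the deciding theorem of this route concludes that registered leaf instead of the Statement decl `ABC` (class rung: servable and labelled, never counted as concluding the summit Statement).

Rationale: WHY THIS LINE. Mechanism: the loss of the principal-unit reduction WP-M is (m!)² = Minkowski-ℓ₁ m! ×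
Mahler m!; in ℓ₂ Mahler's reduction
costs only √(m!) (nearest-plane reduction, Pythagoras) and passing ℓ₁ ↔ ℓ₂ costs nothing net (√m per
vector from
Cauchy–Schwarz against m^(m/2) from the ball volume), so the heights envelope drops from m^(2m) to
m^m·√(m!) ≤ m^(3m/2) and
the κ of the glue from c₂ + 2 to c₂ + 3/2 [EvertseGyory2015 Thm 4.3.3, Cassels1997, StewartYu1991
§3]. Imported from the
geometry of numbers (reduction theory) into the Baker-method bookkeeping with the explicit
dictionary covolume ↦ p,
weights ↦ log q_i, basis ↦ principal generators. Theorem A (c₂ ≤ 1) and the odd κ-door are the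
cell's landed theorems
[Yu1989, Waldschmidt1980, CijsouwWaldschmidt1977, StewartTijdeman1986].

RANKED CRUXES. #2 WPMFlat (crux) — WP-M♭: for p odd, distinct primes q_i ≠ p, e ≠ 0 with ord_p(∏
q_i^(e_i) − 1) ≥ 1, there are rationals α_j ≡ 1 (mod p), multiplicatively independent, Kummer-free,
and e' ≠ 0 with ∏ q_i^(e_i) = ∏ α_j^(e'_j), ∏ h(α_j) ≤ m^m·√(m!)·p·∏ log q_i, |e'_j| ≤ m^(2m)·p·(∏
log q_i)·max|e_i|, log p ≤ 2 h(α_j). PROVED in the tree: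
`Summit.ABC.StewartYu.PrincipalLattice.exists_principal_generators_sharp` (p418277) — closer is one
line. [difficulty: provable-now] (why it might fail: It cannot as stated (kernel theorem p418277);
the risk is only clerical (statement drift between this text and the landed theorem: heights clause
m^m·√(m!), exponent clause m^(2m) unchanged).) [EvertseGyory2015, Cassels1997, Yu1989]
#3 TheoremAOne (crux) — Theorem A with cap c₂ ≤ 1 (the text of route PadicPrincipalCoreRadThree's
TheoremAOne, item stmt-ABC-19165, CLOSED 2026-08-26T01:27:51Z by
`Summit.ABC.ABC.Theorems.padicPrincipalCoreRadThree_theoremAOne_proof`): p odd; α_j ≡ 1 (mod p)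
independent and Kummer-free; h(α_j) ≤ V_j, log p ≤ V_j ≤ Vmax; b ≠ 0, log max(3,|b_j|) ≤ W ⇒ ord_p(∏
α_j^(b_j) − 1)·log p ≤ C(m)·(∏ V_j)·(W + log 2Vmax)·log 2Vmax/(log p)^r(m) with C(m) ≤ c₁^m·m^m.
[difficulty: provable-now] (why it might fail: It cannot (closed item stmt-ABC-19165, shared by
signature); listed as a crux because it is the load-bearing analytic input of the rung and the crux
floor counts declared cruxes.) [Yu1989, Waldschmidt1980, CijsouwWaldschmidt1977]
#9 GlueSpecFlat (support) — The glue with the flat envelope: WP-M♭ and any Theorem-A-shaped bound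
with envelope C(m) ≤ c₁^m·m^(c₂ m) give the one-prime bound at every odd prime with exponents (κ, σ,
τ, τ₁) = (≤ c₂ + 3/2, 2, 2, 2). In the tree:
`Summit.ABC.StewartYu.primePadicBoundAt_odd_of_principal_general` (p418144) with A(m) = m^m·√(m!) ≤
m^((3/2)·m) (envelope lemma of p418490), c₄ = 3/2, K = 4704, L = 32 c₁ — a few-line instantiation.
[difficulty: provable-now] [StewartYu1991, Yu1989]
#9 OddKappaDoorSpec (support) — The κ-door at the odd places (text of route
PadicPrincipalCoreRadThree's OddKappaDoorSpec, item stmt-ABC-19895, CLOSED): the one-prime bound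
with σ ≤ 2 at every ODD prime (any K ≥ 0, L ≥ 1, κ ≥ 0) gives EpsShapeBound (max 1 κ). In the tree:
`Summit.ABC.StewartYu.KappaDoor.epsShape_of_oddFinBound`. [difficulty: provable-now] [StewartYu1991,
StewartTijdeman1986]

TWO-LAYER PLAN. None: every item is a landed theorem; the closers are one-liners by name (p1/p3).

KILL CRITERIA. None mathematical (all items proved). Clerical: if the leaf `EpsShapeBoundFiveHalves`
is not registered as an ALT-CLOSER
the route cannot be born; if a closer's statement drifts from the landed theorem the gate's
type-match fails and the text
is restated 1:1 (`route edit --restate`).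

NOT DECOMPOSED YET. Nothing. The next rungs on this ladder are separate routes: rad^(2+ε) (WPMSharp:
an ℓ₂ basis within C^m·m^(m/2)·covol —
the orthogonality-defect question; staged routeB2.json, leaf EpsShapeBoundTwo wanted) and
rad^(5/3+ε) (Theorem A at
p = 2 by q = 3 descent = route PadicPrimesYuNinety's stub_engineTwo, + WP-M♭ + the three-slot
κ-door; leaf wanted).

CHEAPEST FALSIFIER. `example : WPMFlat :=
Summit.ABC.StewartYu.PrincipalLattice.exists_principal_generators_sharp` must elaborate (statement
drift check) — run by the closer's author; and the glue's arithmetic κ ≤ 1 + 3/2 = 5/2 (done: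
SketchB52.lean rc 0).

NUMBERS. c₂ = 1, c₁ = 2^70, A(m) = m^m·√(m!) ≤ m^(3m/2), c₄ = 3/2, κ = 5/2, σ = τ = τ₁ = 2, K =
4704, L = 32·c₁; 1 530 landed lines
(p416751, p417147, p417582, p418277, p418144, p418490).

Novelty: Searches run: `lit search --hybrid "Mahler basis reduction nearest plane weighted Minkowski second
theorem product of
basis norms"`, `lit galaxy search "orthogonality defect|Mahler basis|successive minima basis" --star
all`, `lean search
'exists_basis_prod'`; tree: `Dioph.exists_directional_system_prod_mul_volume_le`. Nearest prior art
found: EvertseGyory2015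
Thm 4.3.3 (Mahler's m!-basis from successive minima), Bost's lecture in Peyre–Rémond 2021 Thm 3.1.1
p. 108 (HKZ defect
(4/3)^(n(n−1)/4)) [corpus: book:peyre2021-arakelov-geometry-diophantine-applications p.108];
Stewart–Yu 1991 do not
re-present generators at all. Delta: the Euclidean nearest-plane variant of Mahler's reduction
(√(m!)) inserted into the
principal-unit architecture of this cell, halving the exponent surplus of the reduction (rung 3 →
5/2); grade expected
variant/new-combination (rung record, not a summit mechanism).  [refs: book:peyre2021-arakelov-geometry-diophantine-applications, EvertseGyory2015]

Barriers (technique_class: baker-linear-forms, geometry-of-numbers): - technique_class: baker-linear-forms, geometry-of-numbers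
- Literature.Barriers.ABC.BakerMethodBounds (Stewart–Yu/Baker-class bounds are exponential in rad):
it does not evade it; the bet is a RUNG inside the class (log c ≪ rad^(5/2+ε)), recorded as class
rung, never summit credit.

History (route lifecycle, newest last):
- 2026-08-26T13:02:45Z · CLOSED proved — proved:Summit.ABC.StewartYu.epsShapeBoundFiveHalves_holds (planner-abc-stewartyu-plan-g6-0)

sub-problem: ABC · status: closed(proved) · opened planner-abc-stewartyu-plan-g4-0 2026-08-26T06:02:30Z · rev 0 · ledger route-ABC-PadicPrincipalCoreRadFiveHalves
GENERATED by the gate from the ledger (D-0016/17). Provers cite these decls: `theorem foo : Summit.ABC.ABC.Theses.PadicPrincipalCoreRadFiveHalves.<Decl> := …` in Summits/ABC/ABC/Theorems/<Name>.lean.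
-/

namespace Summit.ABC.ABC.Theses.PadicPrincipalCoreRadFiveHalves

open scoped BigOperators Topology Manifold Classical MeasureTheory ProbabilityTheory Matrix InnerProductSpace ComplexConjugate ContinuousMap
open Filter Set Function TopologicalSpace MeasureTheory

attribute [summit_statement] _root_.ABC
attribute [summit_statement] _root_.Literature.Barriers.ABC.EpsShapeBoundFiveHalves

open Literature.Abc

/-- item stmt-ABC-19413 · crux · rank 2 · closed · proved by Summit.ABC.ABC.Theorems.padicPrincipalCoreRadFiveHalves_wpmFlat_proof (prover) · by planner
why it might fail: It cannot as stated (kernel theorem p418277); the risk is only clerical (statement drift between this text and the landed theorem: heights clause m^m·√(m!), exponent clause m^(2m) unchanged).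
sources: EvertseGyory2015, Cassels1997, Yu1989
[crux] WP-M♭: for p odd, distinct primes q_i ≠ p, e ≠ 0 with ord_p(∏ q_i^(e_i) − 1) ≥ 1, there are
rationals α_j ≡ 1 (mod p), multiplicatively independent, Kummer-free, and e' ≠ 0 with ∏ q_i^(e_i) =
∏ α_j^(e'_j), ∏ h(α_j) ≤ m^m·√(m!)·p·∏ log q_i, |e'_j| ≤ m^(2m)·p·(∏ log q_i)·max|e_i|, log p ≤ 2
h(α_j). PROVED in the tree:
`Summit.ABC.StewartYu.PrincipalLattice.exists_principal_generators_sharp` (p418277) — closer is one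
line. [difficulty: provable-now] -/
@[route_item "route-ABC-PadicPrincipalCoreRadFiveHalves", crux]
def WPMFlat : Prop :=
  ∀ (p : ℕ), p.Prime → p ≠ 2 → ∀ (m : ℕ) (q : Fin m → ℕ), (∀ i, (q i).Prime) → Function.Injective q → (∀ i, q i ≠ p) → ∀ (e : Fin m → ℤ), e ≠ 0 → 1 ≤ padicValRat p (∏ i, (q i : ℚ) ^ e i - 1) → ∃ (α : Fin m → ℚ) (e' : Fin m → ℤ), (∀ j, α j ≠ 0 ∧ 1 ≤ padicValRat p (α j - 1)) ∧ (∀ μ : Fin m → ℤ, ∏ j, α j ^ μ j = 1 → μ = 0) ∧ (∀ T : Finset (Fin m), T.Nonempty → ¬ IsSquare (∏ j ∈ T, α j)) ∧ e' ≠ 0 ∧ ∏ i, (q i : ℚ) ^ e i = ∏ j, α j ^ e' j ∧ (∏ j, Height.logHeight₁ (α j)) ≤ (m : ℝ) ^ m * Real.sqrt (m.factorial) * p * ∏ i, Real.log (q i) ∧ (∀ j, (|e' j| : ℝ) ≤ (m : ℝ) ^ (2 * m) * p * (∏ i, Real.log (q i)) * (Finset.univ.sup fun i => (e i).natAbs))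 ∧ (∀ j, Real.log p ≤ 2 * Height.logHeight₁ (α j))

-- `WPMFlat` holds: proved by `Summit.ABC.ABC.Theorems.padicPrincipalCoreRadFiveHalves_wpmFlat_proof` (its module imports this route file, so no `_holds` link can be stated here).

/-- item stmt-ABC-19414 · crux · rank 3 · closed · proved by Summit.ABC.ABC.Theorems.padicPrincipalCoreRadFiveHalves_theoremAOne_proof (prover) · by planner
why it might fail: It cannot (closed item stmt-ABC-19165, shared by signature); listed as a crux because it is the load-bearing analytic input of the rung and the crux floor counts declared cruxes.
sources: Yu1989, Waldschmidt1980, CijsouwWaldschmidt1977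
[crux] Theorem A with cap c₂ ≤ 1 (the text of route PadicPrincipalCoreRadThree's TheoremAOne, item
stmt-ABC-19165, CLOSED 2026-08-26T01:27:51Z by
`Summit.ABC.ABC.Theorems.padicPrincipalCoreRadThree_theoremAOne_proof`): p odd; α_j ≡ 1 (mod p)
independent and Kummer-free; h(α_j) ≤ V_j, log p ≤ V_j ≤ Vmax; b ≠ 0, log max(3,|b_j|) ≤ W ⇒ ord_p(∏
α_j^(b_j) − 1)·log p ≤ C(m)·(∏ V_j)·(W + log 2Vmax)·log 2Vmax/(log p)^r(m) with C(m) ≤ c₁^m·m^m.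
[difficulty: provable-now] -/
@[route_item "route-ABC-PadicPrincipalCoreRadFiveHalves", crux]
def TheoremAOne : Prop :=
  ∃ (C : ℕ → ℝ) (r : ℕ → ℕ) (c₁ c₂ : ℝ), 1 ≤ c₁ ∧ 0 ≤ c₂ ∧ c₂ ≤ 1 ∧ (∀ m, 0 ≤ C m ∧ C m ≤ c₁ ^ m * (m : ℝ) ^ (c₂ * m)) ∧ (∀ (p : ℕ), p.Prime → p ≠ 2 → ∀ (m : ℕ) (α : Fin m → ℚ) (b : Fin m → ℤ) (V : Fin m → ℝ) (Vmax W : ℝ), (∀ j, α j ≠ 0 ∧ 1 ≤ padicValRat p (α j - 1)) → (∀ μ : Fin m → ℤ, ∏ j, α j ^ μ j = 1 → μ = 0) → (∀ T : Finset (Fin m), T.Nonempty → ¬ IsSquare (∏ j ∈ T, α j)) → (∀ j, Height.logHeight₁ (α j) ≤ V j) → (∀ j, Real.log p ≤ V j) → (∀ j, V j ≤ Vmax) → b ≠ 0 → (∀ j, Real.log (max 3 (|b j| : ℝ)) ≤ W) → (padicValRat p (∏ j, α j ^ b j - 1) : ℝ) * Real.log p ≤ C m * (∏ j, V j) * (W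 + Real.log (2 * Vmax)) * Real.log (2 * Vmax) / Real.log p ^ r m)

-- `TheoremAOne` holds: proved by `Summit.ABC.ABC.Theorems.padicPrincipalCoreRadFiveHalves_theoremAOne_proof` (its module imports this route file, so no `_holds` link can be stated here).

/-- item stmt-ABC-19415 · support · rank 9 · closed · proved by Summit.ABC.ABC.Theorems.padicPrincipalCoreRadFiveHalves_glueSpecFlat_proof (prover) · by planner
sources: StewartYu1991, Yu1989
[support] The glue with the flat envelope: WP-M♭ and any Theorem-A-shaped bound with envelope C(m) ≤
c₁^m·m^(c₂ m) give the one-prime bound at every odd prime with exponents (κ, σ, τ, τ₁) = (≤ c₂ +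
3/2, 2, 2, 2). In the tree: `Summit.ABC.StewartYu.primePadicBoundAt_odd_of_principal_general`
(p418144) with A(m) = m^m·√(m!) ≤ m^((3/2)·m) (envelope lemma of p418490), c₄ = 3/2, K = 4704, L =
32 c₁ — a few-line instantiation. [difficulty: provable-now] -/
@[route_item "route-ABC-PadicPrincipalCoreRadFiveHalves", crux]
def GlueSpecFlat : Prop :=
  (∀ (p : ℕ), p.Prime → p ≠ 2 → ∀ (m : ℕ) (q : Fin m → ℕ), (∀ i, (q i).Prime) → Function.Injective q → (∀ i, q i ≠ p) → ∀ (e : Fin m → ℤ), e ≠ 0 → 1 ≤ padicValRat p (∏ i, (q i : ℚ) ^ e i - 1) → ∃ (α : Fin m → ℚ) (e' : Fin m → ℤ), (∀ j, α j ≠ 0 ∧ 1 ≤ padicValRat p (α j - 1)) ∧ (∀ μ : Fin m → ℤ, ∏ j, α j ^ μ j = 1 → μ = 0) ∧ (∀ T : Finset (Fin m), T.Nonempty → ¬ IsSquare (∏ j ∈ T, α j)) ∧ e' ≠ 0 ∧ ∏ i, (q i : ℚ) ^ e i = ∏ j, α j ^ e' j ∧ (∏ j, Height.logHeight₁ (α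 j)) ≤ (m : ℝ) ^ m * Real.sqrt (m.factorial) * p * ∏ i, Real.log (q i) ∧ (∀ j, (|e' j| : ℝ) ≤ (m : ℝ) ^ (2 * m) * p * (∏ i, Real.log (q i)) * (Finset.univ.sup fun i => (e i).natAbs)) ∧ (∀ j, Real.log p ≤ 2 * Height.logHeight₁ (α j))) → ∀ (C : ℕ → ℝ) (r : ℕ → ℕ) (c₁ c₂ : ℝ), 1 ≤ c₁ → 0 ≤ c₂ → (∀ m, 0 ≤ C m ∧ C m ≤ c₁ ^ m * (m : ℝ) ^ (c₂ * m)) → (∀ (p : ℕ), p.Prime → p ≠ 2 → ∀ (m : ℕ) (α : Fin m → ℚ) (b : Fin m → ℤ) (V : Fin m → ℝ) (Vmax W : ℝ), (∀ j, α j ≠ 0 ∧ 1 ≤ padicValRat p (α j - 1)) → (∀ μ : Fin m → ℤ, ∏ j, α j ^ μ j = 1 → μ = 0) → (∀ T : Finset (Fin m), T.Nonempty → ¬ IsSquare (∏ j ∈ T, α j)) → (∀ j, Height.logHeight₁ (α j) ≤ V j) → (∀ j, Real.log p ≤ V j) → (∀ j, V j ≤ Vmax) → b ≠ 0 → (∀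 j, Real.log (max 3 (|b j| : ℝ)) ≤ W) → (padicValRat p (∏ j, α j ^ b j - 1) : ℝ) * Real.log p ≤ C m * (∏ j, V j) * (W + Real.log (2 * Vmax)) * Real.log (2 * Vmax) / Real.log p ^ r m) → ∃ (K L κ : ℝ), 0 ≤ K ∧ 1 ≤ L ∧ 0 ≤ κ ∧ κ ≤ c₂ + 3 / 2 ∧ ∀ p, p.Prime → p ≠ 2 → (∀ (n : ℕ) (q : Fin n → ℕ) (e : Fin n → ℤ), (∀ i, (q i).Prime) → Function.Injective q → (∀ i, q i ≠ p) → e ≠ 0 → ∏ i, ((q i : ℚ)) ^ e i ≠ 1 → (padicValRat p (∏ i, ((q i : ℚ)) ^ e i - 1) : ℝ) ≤ K * L ^ n * (n : ℝ) ^ (κ * n) * (p : ℝ) ^ (2:ℝ) * (∏ i, Real.log (q i)) * Real.log (max 3 ((Finset.univ.sup fun i => (e i).natAbs : ℕ) : ℝ)) ^ (2:ℕ) * Real.log (max 3 (∏ i, ((q i : ℕ) : ℝ))) ^ (2:ℕ))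

-- `GlueSpecFlat` holds: proved by `Summit.ABC.ABC.Theorems.padicPrincipalCoreRadFiveHalves_glueSpecFlat_proof` (its module imports this route file, so no `_holds` link can be stated here).

/-- item stmt-ABC-19416 · support · rank 9 · closed · proved by Summit.ABC.ABC.Theorems.padicPrincipalCoreRadFiveHalves_oddKappaDoorSpec_proof (prover) · by planner
sources: StewartYu1991, StewartTijdeman1986
[support] The κ-door at the odd places (text of route PadicPrincipalCoreRadThree's OddKappaDoorSpec,
item stmt-ABC-19895, CLOSED): the one-prime bound with σ ≤ 2 at every ODD prime (any K ≥ 0, L ≥ 1, κ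
≥ 0) gives EpsShapeBound (max 1 κ). In the tree:
`Summit.ABC.StewartYu.KappaDoor.epsShape_of_oddFinBound`. [difficulty: provable-now] -/
@[route_item "route-ABC-PadicPrincipalCoreRadFiveHalves", crux]
def OddKappaDoorSpec : Prop :=
  ∀ (K L κ σ : ℝ) (τ τ₁ : ℕ), 0 ≤ K → 1 ≤ L → 0 ≤ κ → 0 ≤ σ → σ ≤ 2 → (∀ p, p.Prime → p ≠ 2 → (∀ (n : ℕ) (q : Fin n → ℕ) (e : Fin n → ℤ), (∀ i, (q i).Prime) → Function.Injective q → (∀ i, q i ≠ p) → e ≠ 0 → ∏ i, ((q i : ℚ)) ^ e i ≠ 1 → (padicValRat p (∏ i, ((q i : ℚ)) ^ e i - 1) : ℝ) ≤ K * L ^ n * (n : ℝ) ^ (κ * n) * (p : ℝ) ^ σ * (∏ i, Real.log (q i)) * Real.log (max 3 ((Finset.univ.sup fun i => (e i).natAbs : ℕ) : ℝ)) ^ τ * Real.log (max 3 (∏ i, ((q i : ℕ) : ℝ))) ^ τ₁)) → Literature.Barriers.ABC.EpsShapeBound (max 1 κ)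

-- `OddKappaDoorSpec` holds: proved by `Summit.ABC.ABC.Theorems.padicPrincipalCoreRadFiveHalves_oddKappaDoorSpec_proof` (its module imports this route file, so no `_holds` link can be stated here).

/-- item stmt-ABC-19417 · assembly · rank 1 · closed · proved by Summit.ABC.ABC.Theorems.padicPrincipalCoreRadFiveHalves_assembly_proof (prover) · by planner
sources: StewartYu1991
[assembly] TheoremAOne → WPMFlat → GlueSpecFlat → OddKappaDoorSpec → the rung leaf
EpsShapeBoundFiveHalves (`closes_target`). [deps: WPMFlat, TheoremAOne, GlueSpecFlat,
OddKappaDoorSpec] [difficulty: provable-now] -/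
@[route_item "route-ABC-PadicPrincipalCoreRadFiveHalves"]
def Assembly : Prop :=
  TheoremAOne → WPMFlat → GlueSpecFlat → OddKappaDoorSpec → Literature.Barriers.ABC.EpsShapeBoundFiveHalves

-- `Assembly` holds: proved by `Summit.ABC.ABC.Theorems.padicPrincipalCoreRadFiveHalves_assembly_proof` (its module imports this route file, so no `_holds` link can be stated here).

/-! D-0027 §2.1 — DECIDING THEOREM (planner-authored via `route open/edit --closes-file`; by planner-abc-stewartyu-plan-g4-0 2026-08-26T06:02:30Z) — ARCHIVED: route closed (proved) 2026-08-26T13:02:45Z; kept so importers keep building: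
its hypotheses are this route's items and its conclusion the registered leaf `Literature.Barriers.ABC.EpsShapeBoundFiveHalves` (rung F-A1.M1⁺(5/2), D-0061) (glue_lint), and it elaborates with this file. -/

@[closes "route-ABC-PadicPrincipalCoreRadFiveHalves"] theorem closes (hA : TheoremAOne) (hM : WPMFlat) (hG : GlueSpecFlat) (hO : OddKappaDoorSpec) :
    Literature.Barriers.ABC.EpsShapeBoundFiveHalves := by
  obtain ⟨C, r, c₁, c₂, hc₁, hc₂, hc₂1, hC, hB⟩ := hA
  obtain ⟨K, L, κ, hK, hL, hκ0, hκ, h⟩ := hG hM C r c₁ c₂ hc₁ hc₂ hC hB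
  exact Literature.Barriers.ABC.epsShapeBound_mono (max_le (by norm_num) (by linarith))
    (hO K L κ 2 2 2 hK hL hκ0 (by norm_num) le_rfl h)

end Summit.ABC.ABC.Theses.PadicPrincipalCoreRadFiveHalves
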